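import Summits.QuantumFields.BalabanUV.T4Continuum.Support.NE7LandauNewtonStep
import HarnessLib

/-!
# NE7LandauNewtonScheme — THE NEWTON SCHEME OF ROAD v4's TOP STEP EXISTS WITH GEOMETRIC DECAY (brick T4b, second half): from a unitary periodic `V` with links `a`-close to `1`,
# plaquettes `ε`, and straight datum `q₀` of `log V`, under ONE smallness line `Θ·m₀ ≤ 1` on `m₀ = n₀·2a + n₀²(ε + 32(2a)²) + n₀q₀` (k- and N-uniform), the sequence
# `u_{i+1} = e^{Φ(N_i)}·u_i`, `E_{i+1} = E_i + (N_i − dΦ(N_i))`, `N_i = log V^{u_i} − E_i` has: `E_i` EXACTLY in the gauge `(1 − P)∂* = 0` entrywise, `‖N_i‖ ≤ (m₀∕n₀)2^{−i}`,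
# `‖E_i‖ ≤ 2(K+K′)m₀∕n₀`, links of `V^{u_i}` within `c_r m₀∕n₀` of `1`, `‖u_{i+1} − u_i‖ ≤ 2c_t m₀ 2^{−i}`, `‖E_{i+1} − E_i‖ ≤ (K+K′)(m₀∕n₀)2^{−i}` (`NE7LandauNewtonScheme`)

Cell `pub-balaban`, lineage `t4-ne7-p1` (CRUX PROVER NE7 #1 = OWNER of row NE7), gen 74; memo `t4/b2b-balaban-t4-ne7-p1-g74/REP-FLAT-ROAD-v4.md` §2–§3.  Assembled BY NAME
from T2′ (`NE7LandauLinearStraightMap.exists_landauMap`: the linear B5-Landau step as a map, order −1 in sup), T3 (`NE7GaugeStepDeviation.gaugeStep_letters`: deviation and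
curl letters of a gauge step) and T4a (`NE7LandauNewtonRates`); the sequence is a `Nat.rec` inside the proof (no `def`).  WHAT IS MEASURED: sup of the deviation `N_i`, its
flat curl (gauge COVARIANCE makes it (−2)-size), its straight average (`|Q_k w| ≤ sup|w|`) — never a divergence (memo §2: the divergence of the Newton junk is (−1)-size; this
is what closes brick E's (−2)-door at the top, desk NE7-TOP-1, and what killed v2.1).  The limit `i → ∞` (T4c) is the exactly gauged representative with `‖log V^{u}‖ ≤ 2(K+K′)m₀∕n₀
= O(δ∕M)` — G7's `hr₀`.
CONTENT ([folklore]; 0 def, 0 sorry; dimension `d + 1`, block side `n₀ ≥ 1`, coarse period `N ≥ 1`).  §1 `newton_invariant` (the twelve-clause invariant along any sequence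
obeying the recursion, over `NE7LandauNewtonStep.newton_step`); §2 **`newton_sequence`**.
HONEST FRAMING (page 1): OUR construction ([B5]'s linear Landau gauge (1.25) iterated at the flat background on the T4 carriers); [B8] Prop. 5 ∕ Thm 2 are about curved
backgrounds with the full (1.36)–(1.39) ladder and are NOT claimed; REP♭ (sup ∧ gradient) NOT proved here (no limit, no gradient yet); (APE) NOT proved; NE7 NOT PRINTED ∕
NOT PROVED (0∕1); spine PROVED 0∕9; rung (B)+1 finite T⁴ — NOT infinite volume, NOT mass gap, NOT BetaPertH, NOT Clay.  PLACEMENT: our lemma, under `Summits/QuantumFields/BalabanUV/`.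
Continuum YM on T⁴ ⇐ BetaPertH ∧ nine spine estimates (0/9 proved); BetaPertH ⇐ (D1) ∧ (D4) ∧ CAP+tail; G-an2-4 gates asym, D1 and NE2/3/4.
-/

set_option autoImplicit false

open scoped BigOperators Matrix Matrix.Norms.L2Operator
open NormedSpace Finset

namespace Summit.QuantumFields.BalabanUV.T4Continuum.NE7LandauNewtonScheme

open Literature.MathematicalPhysics.QuantumFieldTheory.Balaban1983to89
open B7Prop1Explicit B7Prop2Explicit MatrixLog
open T4AveragingDeficitWall (IsUnitaryCfg IsSkewDir SmallField vary curlAt)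
open T4AveragingDeficitWallBoundary (IsPeriodicCfg)
open AveragingDeficitPeriodicCounting (IsPeriodicDir)
open AveragingDeficitKDatum (isUnitaryCfg_gaugeAct)
open BlockAverageCurrent (smallField_gaugeAct)
open BlockAveragePushDirSplit (flat)
open NE3EnergyShapes (IsUnitarySite IsPeriodicSite gaugeAct_one)
open NE3SmoothLiftCurl (curlAt_flat_eq)
open NE3SmoothLiftW (isPeriodicCfg_gaugeAct)
open B5Prop11Plancherel (Tor fine)
open B5Action121 (GradOp)
open B5Block118 (QvOp)
open B5Value126 (PcT)
open B6LowerBound2153Torus (rep)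
open NE7GradientCurrency (vary_flat_one_apply)
open NE7SliceStepLetters (norm_curlAt_flat_le_of_plaq)
open NE7LandauLinearStraightMap (exists_landauMap norm_QvOp_mulVec_le)
open NE7LandauNewtonRates (rate_t rate_eta rate_small rate_init)
open NE7LandauNewtonStep (newton_step norm_mul_sub_one_le_of_unitary)
open Literature.Computability.QuantumComplexity.SolovayKitaev (norm_apply_le_norm)

noncomputable section

variable {d : ℕ} {n : Type*} [Fintype n] [DecidableEq n]

/-! ## §1 The invariant along any sequence obeying the recursion -/

-- the twelve-clause invariant is one elaboration unit; the default heartbeat budget is about 20 % short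
set_option maxHeartbeats 400000 in
/-- **THE INVARIANT OF THE SCHEME** (`Inv i`, twelve clauses; see the module docstring): for ANY sequence of states `(u_i, E_i)` obeying `u_0 = 1`, `E_0 = 0` and the
recursion `u_{i+1} = e^{Φ N_i}·u_i`, `E_{i+1} = E_i + (N_i − dΦ N_i)`, `N_i = log V^{u_i} − E_i`, with `Φ` the linear step of T2′ and the smallness line in force.
[folklore] -/
theorem newton_invariant [Nonempty n] {n₀ N : ℕ} [NeZero n₀] [NeZero N] {V : Site (d + 1) → Fin (d + 1) → (Matrix n n ℂ)ˣ} {ε a q₀ : ℝ}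
    (hVu : IsUnitaryCfg V) (hVP : IsPeriodicCfg V ((n₀ * N : ℕ) : ℤ)) (hε : 0 ≤ ε) (hVε : SmallField V ε)
    (ha : ∀ (y : Site (d + 1)) (κ : Fin (d + 1)), ‖((V y κ : (Matrix n n ℂ)ˣ) : Matrix n n ℂ) - 1‖ ≤ a)
    (hq : ∀ (j j' : n) (t : Tor (fun _ : Fin (d + 1) => N)) (κ : Fin (d + 1)),
      ‖(QvOp n₀ (fun _ : Fin (d + 1) => N) *ᵥ fun p : Tor (fine n₀ (fun _ : Fin (d + 1) => N)) × Fin (d + 1) =>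
        mlog ((V (rep (fine n₀ (fun _ : Fin (d + 1) => N)) p.1) p.2 : (Matrix n n ℂ)ˣ) : Matrix n n ℂ) j j') (t, κ)‖ ≤ q₀)
    {K K' m₀ ct cδ cr : ℝ} (hK : 0 ≤ K) (hK' : 0 ≤ K') (hm0 : 0 ≤ m₀) (hm1 : m₀ ≤ 1)
    (h2a : 2 * a ≤ m₀ / n₀) (hB₀ : ε + 32 * (2 * a) ^ 2 ≤ m₀ / (n₀ : ℝ) ^ 2) (hq₀x : q₀ ≤ m₀ / n₀) (hεx : ε ≤ m₀ / (n₀ : ℝ) ^ 2)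
    (hct : ct = ((d + 1 : ℕ) : ℝ) * (Fintype.card n + K + K')) (hcδ : cδ = 1 + K + K') (hcr : cr = 4 * (K + K') + 1 + 8 * (ct + cδ) * cδ)
    (hcr80 : cr * m₀ ≤ 1 / 80) (hct40 : ct * m₀ ≤ 1 / 40) (hcδ40 : cδ * m₀ ≤ 1 / 40) (hline1 : 8 * (ct + cδ) * (2 * cr + cδ) * m₀ ≤ 1)
    (hline2 : 2 * (4 * ct + 128 * cr * (cδ + 1 / 2)) * m₀ ≤ 1)
    {Φ : (Site (d + 1) → Fin (d + 1) → Matrix n n ℂ) → (Site (d + 1) → Matrix n n ℂ)}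
    (hΦ : ∀ Z : Site (d + 1) → Fin (d + 1) → Matrix n n ℂ,
        (∀ (y : Site (d + 1)) (ι : Fin (d + 1)), Φ Z (y + ((n₀ * N : ℕ) : ℤ) • e ι) = Φ Z y) ∧
        (IsSkewDir Z → ∀ y : Site (d + 1), Φ Z y ∈ skewAdjoint (Matrix n n ℂ)) ∧
        (∀ i i' : n, (1 - PcT n₀ (fun _ : Fin (d + 1) => N) (n₀ : ℂ)) *ᵥ ((GradOp (fine n₀ (fun _ : Fin (d + 1) => N)) (n₀ : ℂ))ᴴ *ᵥ
          fun p : Tor (fine n₀ (fun _ : Fin (d + 1) => N)) × Fin (d + 1) =>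
            (Z (rep (fine n₀ (fun _ : Fin (d + 1) => N)) p.1) p.2
              - (Φ Z (rep (fine n₀ (fun _ : Fin (d + 1) => N)) p.1 + e p.2) - Φ Z (rep (fine n₀ (fun _ : Fin (d + 1) => N)) p.1))) i i') = 0) ∧
        (∀ (i i' : n) (t : Tor (fun _ : Fin (d + 1) => N)) (κ : Fin (d + 1)),
          (QvOp n₀ (fun _ : Fin (d + 1) => N) *ᵥ fun p : Tor (fine n₀ (fun _ : Fin (d + 1) => N)) × Fin (d + 1) =>
            (Z (rep (fine n₀ (fun _ : Fin (d + 1) => N)) p.1) p.2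
              - (Φ Z (rep (fine n₀ (fun _ : Fin (d + 1) => N)) p.1 + e p.2) - Φ Z (rep (fine n₀ (fun _ : Fin (d + 1) => N)) p.1))) i i') (t, κ)
          = (QvOp n₀ (fun _ : Fin (d + 1) => N) *ᵥ fun p : Tor (fine n₀ (fun _ : Fin (d + 1) => N)) × Fin (d + 1) =>
            Z (rep (fine n₀ (fun _ : Fin (d + 1) => N)) p.1) p.2 i i') (t, κ)) ∧
        (IsPeriodicDir Z ((n₀ * N : ℕ) : ℤ) →
          ∀ (B : ℝ), (∀ (x : Site (d + 1)) (μ ν : Fin (d + 1)), ‖curlAt (flat (d := d + 1) (n := n)) Z x μ ν‖ ≤ B) →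
          ∀ (q : ℝ), (∀ (i i' : n) (t : Tor (fun _ : Fin (d + 1) => N)) (κ : Fin (d + 1)),
            ‖(QvOp n₀ (fun _ : Fin (d + 1) => N) *ᵥ fun p : Tor (fine n₀ (fun _ : Fin (d + 1) => N)) × Fin (d + 1) =>
              Z (rep (fine n₀ (fun _ : Fin (d + 1) => N)) p.1) p.2 i i') (t, κ)‖ ≤ q) →
          ∀ (b : ℝ), (∀ (y : Site (d + 1)) (κ : Fin (d + 1)), ‖Z y κ‖ ≤ b) →
          (∀ (y : Site (d + 1)) (κ : Fin (d + 1)), ‖Z y κ - (Φ Z (y + e κ) - Φ Z y)‖ ≤ K * (n₀ : ℝ) * B + K' * q) ∧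
          (∀ y : Site (d + 1), ‖Φ Z y‖ ≤ ((d + 1 : ℕ) : ℝ) * ((n₀ : ℝ) - 1) * (Fintype.card n * b + K * (n₀ : ℝ) * B + K' * q))))
    {Nf : (Site (d + 1) → (Matrix n n ℂ)ˣ) × (Site (d + 1) → Fin (d + 1) → Matrix n n ℂ) → (Site (d + 1) → Fin (d + 1) → Matrix n n ℂ)}
    (hNf : ∀ s y κ, Nf s y κ = mlog ((gaugeAct s.1 V y κ : (Matrix n n ℂ)ˣ) : Matrix n n ℂ) - s.2 y κ)
    {seq : ℕ → (Site (d + 1) → (Matrix n n ℂ)ˣ) × (Site (d + 1) → Fin (d + 1) → Matrix n n ℂ)}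
    (hseq_zero : seq 0 = (fun _ => 1, fun _ _ => 0))
    (hseq_succ : ∀ i, seq (i + 1) = (fun y => expUnit (Φ (Nf (seq i)) y) * (seq i).1 y,
      fun y κ => (seq i).2 y κ + (Nf (seq i) y κ - (Φ (Nf (seq i)) (y + e κ) - Φ (Nf (seq i)) y)))) (i : ℕ) :
    IsUnitarySite (seq i).1 ∧ IsPeriodicSite (seq i).1 ((n₀ * N : ℕ) : ℤ) ∧ IsSkewDir (seq i).2 ∧ IsPeriodicDir (seq i).2 ((n₀ * N : ℕ) : ℤ) ∧
      (∀ j j' : n, (1 - PcT n₀ (fun _ : Fin (d + 1) => N) (n₀ : ℂ)) *ᵥ ((GradOp (fine n₀ (fun _ : Fin (d + 1) => N)) (n₀ : ℂ))ᴴ *ᵥ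
        fun p : Tor (fine n₀ (fun _ : Fin (d + 1) => N)) × Fin (d + 1) => (seq i).2 (rep (fine n₀ (fun _ : Fin (d + 1) => N)) p.1) p.2 j j') = 0) ∧
      (∀ (y : Site (d + 1)) (κ : Fin (d + 1)), ‖(seq i).2 y κ‖ ≤ 2 * (K + K') * (m₀ / n₀) * (1 - (1 / 2 : ℝ) ^ i)) ∧
      (∀ (j j' : n) (t : Tor (fun _ : Fin (d + 1) => N)) (κ : Fin (d + 1)),
        ‖(QvOp n₀ (fun _ : Fin (d + 1) => N) *ᵥ fun p : Tor (fine n₀ (fun _ : Fin (d + 1) => N)) × Fin (d + 1) =>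
          (seq i).2 (rep (fine n₀ (fun _ : Fin (d + 1) => N)) p.1) p.2 j j') (t, κ)‖ ≤ 2 * (m₀ / n₀) * (1 - (1 / 2 : ℝ) ^ i)) ∧
      (∀ (y : Site (d + 1)) (κ : Fin (d + 1)), ‖((gaugeAct (seq i).1 V y κ : (Matrix n n ℂ)ˣ) : Matrix n n ℂ) - 1‖ ≤ cr * (m₀ / n₀)) ∧
      (∀ (y : Site (d + 1)) (κ : Fin (d + 1)), ‖Nf (seq i) y κ‖ ≤ m₀ / n₀ * (1 / 2 : ℝ) ^ i) ∧
      (∀ (z : Site (d + 1)) (μ ν : Fin (d + 1)), ‖curlAt (flat (d := d + 1) (n := n)) (Nf (seq i)) z μ ν‖ ≤ m₀ / n₀ ^ 2 * (1 / 2 : ℝ) ^ i) ∧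
      (∀ (j j' : n) (t : Tor (fun _ : Fin (d + 1) => N)) (κ : Fin (d + 1)),
        ‖(QvOp n₀ (fun _ : Fin (d + 1) => N) *ᵥ fun p : Tor (fine n₀ (fun _ : Fin (d + 1) => N)) × Fin (d + 1) =>
          Nf (seq i) (rep (fine n₀ (fun _ : Fin (d + 1) => N)) p.1) p.2 j j') (t, κ)‖ ≤ m₀ / n₀ * (1 / 2 : ℝ) ^ i) ∧
      (∀ y : Site (d + 1), ‖(((seq i).1 y : (Matrix n n ℂ)ˣ) : Matrix n n ℂ) - 1‖ ≤ 4 * ct * m₀ * (1 - (1 / 2 : ℝ) ^ i)) := by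
  letI : CStarAlgebra (Matrix n n ℂ) := {}
  have hn1 : (1 : ℝ) ≤ n₀ := by exact_mod_cast Nat.one_le_iff_ne_zero.mpr (NeZero.ne n₀)
  have hn0 : (0 : ℝ) < n₀ := by linarith
  have ha0 : 0 ≤ a := (norm_nonneg _).trans (ha 0 0)
  have hct0 : 0 ≤ ct := by rw [hct]; positivity
  have hcδ0 : 0 ≤ cδ := by rw [hcδ]; positivity
  have hcr1 : 1 ≤ cr := by
    rw [hcr]
    have : 0 ≤ 8 * (ct + cδ) * cδ := by positivity
    linarith
  have hcr0 : 0 ≤ cr := by linarith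
  have hx0 : 0 ≤ m₀ / n₀ := by positivity
  have hxm : m₀ / n₀ ≤ m₀ := div_le_self hm0 hn1
  have hm80 : m₀ ≤ 1 / 80 := by nlinarith
  have hr4 : cr * (m₀ / n₀) ≤ 1 / 4 := ((mul_le_mul_of_nonneg_left hxm hcr0).trans hcr80).trans (by norm_num)
  induction i with
    | zero =>
      -- `u = 1`, `E = 0`, `N = log V`
      rw [hseq_zero]
      have hW : gaugeAct (fun _ : Site (d + 1) => (1 : (Matrix n n ℂ)ˣ)) V = V := gaugeAct_one V
      have hN0 : ∀ (y : Site (d + 1)) (κ : Fin (d + 1)),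
          Nf (fun _ => 1, fun _ _ => 0) y κ = mlog ((V y κ : (Matrix n n ℂ)ˣ) : Matrix n n ℂ) := by
        intro y κ; rw [hNf]; simp only [hW, sub_zero]
      have hN0' : Nf (fun _ => 1, fun _ _ => 0) = fun y κ => mlog ((V y κ : (Matrix n n ℂ)ˣ) : Matrix n n ℂ) := by
        funext y κ; exact hN0 y κ
      have hlogV : ∀ (y : Site (d + 1)) (κ : Fin (d + 1)), ‖mlog ((V y κ : (Matrix n n ℂ)ˣ) : Matrix n n ℂ)‖ ≤ 2 * a := fun y κ =>
        (norm_mlog_le_two_mul ((ha y κ).trans (by linarith))).trans (by linarith [ha y κ])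
      refine ⟨fun y => (unitaryUnits _).one_mem, fun y ι => rfl, fun y κ => by simp, fun y ι κ => rfl, fun j j' => ?_, fun y κ => ?_,
        fun j j' t κ => ?_, fun y κ => ?_, fun y κ => ?_, fun z μ ν => ?_, fun j j' t κ => ?_, fun y => ?_⟩
      · have h0 : (fun p : Tor (fine n₀ (fun _ : Fin (d + 1) => N)) × Fin (d + 1) =>
            (0 : Site (d + 1) → Fin (d + 1) → Matrix n n ℂ) (rep (fine n₀ (fun _ : Fin (d + 1) => N)) p.1) p.2 j j') = 0 := by
          funext p; rfl
        simp only []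
        rw [show (fun p : Tor (fine n₀ (fun _ : Fin (d + 1) => N)) × Fin (d + 1) =>
            (fun (_ : Site (d + 1)) (_ : Fin (d + 1)) => (0 : Matrix n n ℂ)) (rep (fine n₀ (fun _ : Fin (d + 1) => N)) p.1) p.2 j j') = 0 from
            funext fun p => rfl, Matrix.mulVec_zero, Matrix.mulVec_zero]
      · simp
      · rw [show (fun p : Tor (fine n₀ (fun _ : Fin (d + 1) => N)) × Fin (d + 1) =>
            (fun (_ : Site (d + 1)) (_ : Fin (d + 1)) => (0 : Matrix n n ℂ)) (rep (fine n₀ (fun _ : Fin (d + 1) => N)) p.1) p.2 j j') = 0 from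
            funext fun p => rfl, Matrix.mulVec_zero]
        simp
      · simp only [hW]
        calc _ ≤ a := ha y κ
          _ ≤ 1 * (m₀ / n₀) := by linarith
          _ ≤ cr * (m₀ / n₀) := mul_le_mul_of_nonneg_right hcr1 hx0
      · rw [hN0, pow_zero, mul_one]; exact (hlogV y κ).trans h2a
      · rw [hN0', pow_zero, mul_one]
        refine (norm_curlAt_flat_le_of_plaq _ (by positivity) ?_ hlogV hε ?_ z μ ν).trans hB₀
        · linarith
        · intro x' μ' ν' hμν
          have hgV : vary (flat (d := d + 1) (n := n)) (fun y κ => mlog ((V y κ : (Matrix n n ℂ)ˣ) : Matrix n n ℂ)) 1 = V := by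
            funext y κ; apply Units.ext; rw [vary_flat_one_apply, val_expUnit]
            exact exp_mlog ((ha y κ).trans_lt (by linarith))
          rw [hgV]; exact hVε x' μ' ν' hμν
      · simp only [hN0, pow_zero, mul_one]; exact (hq j j' t κ).trans hq₀x
      · simp
    | succ i ih =>
      -- freeze the old state `(u, E)`, its deviation `N` and gauge function `σ`
      rw [hseq_succ i]
      generalize hs : seq i = s at ih ⊢
      obtain ⟨u, E⟩ := s
      obtain ⟨hu, huP, hEs, hEP, hEx, hEn, hEq, hWr, hNn, hNc, hNq, hu1⟩ := ih
      dsimp only at hu huP hEs hEP hEx hEn hEq hWr hu1 ⊢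
      generalize hNgen : Nf (u, E) = Nn at hNn hNc hNq ⊢
      have hNn_def : ∀ (y : Site (d + 1)) (κ : Fin (d + 1)), Nn y κ = mlog ((gaugeAct u V y κ : (Matrix n n ℂ)ˣ) : Matrix n n ℂ) - E y κ := by
        intro y κ; rw [← hNgen, hNf]
      have hθsucc' : (1 / 2 : ℝ) ^ (i + 1) = (1 / 2 : ℝ) ^ i / 2 := by rw [pow_succ]; ring
      generalize hθgen : (1 / 2 : ℝ) ^ i = θ at hEn hEq hNn hNc hNq hu1 hθsucc'
      have hθ0 : 0 ≤ θ := by rw [← hθgen]; positivity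
      have hθ1 : θ ≤ 1 := by rw [← hθgen]; exact pow_le_one₀ (by norm_num) (by norm_num)
      -- `N` is skew and periodic
      have hWu : IsUnitaryCfg (gaugeAct u V) := isUnitaryCfg_gaugeAct hu hVu
      have hWP : IsPeriodicCfg (gaugeAct u V) ((n₀ * N : ℕ) : ℤ) := isPeriodicCfg_gaugeAct huP hVP
      have hNs : IsSkewDir Nn := by
        intro y κ
        rw [hNn_def]
        have h1 : mlog ((gaugeAct u V y κ : (Matrix n n ℂ)ˣ) : Matrix n n ℂ) ∈ skewAdjoint (Matrix n n ℂ) :=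
          skewAdjoint.mem_iff.mpr (star_mlog_eq_neg (mem_unitaryUnits.mp (hWu y κ)) ((hWr y κ).trans hr4))
        exact (skewAdjoint (Matrix n n ℂ)).sub_mem h1 (hEs y κ)
      have hNP : IsPeriodicDir Nn ((n₀ * N : ℕ) : ℤ) := by
        intro y ι κ
        rw [hNn_def, hNn_def, hWP y ι κ, hEP y ι κ]
      -- T2′ on `N`, then the step
      obtain ⟨hσP, hσs', hσx, hσQ, hσest⟩ := hΦ Nn
      have hσs := hσs' hNs
      obtain ⟨hNσ, hσn⟩ := hσest hNP _ hNc _ hNq _ hNn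
      generalize hσgen : Φ Nn = σ at hσP hσs hσx hσQ hNσ hσn ⊢
      obtain ⟨hgU, hgP, ht, hηb, hE'n, hlink, hN'n, hN'c⟩ := newton_step hVu hVP hε hVε hK hK' hm0 hm1 hθ0 hθ1 hct hcδ hcr hcr80 hct40 hcδ40
        hline1 hline2 hεx hu huP hNn_def hEn hWr hNn hσP hσs hNσ hσn
      have hct0' : 0 ≤ ct * m₀ * θ := mul_nonneg (mul_nonneg hct0 hm0) hθ0
      -- the torus restriction of `E′` splits
      have hsum : ∀ j j' : n, (fun p : Tor (fine n₀ (fun _ : Fin (d + 1) => N)) × Fin (d + 1) =>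
            (fun y κ => E y κ + (Nn y κ - (σ (y + e κ) - σ y))) (rep (fine n₀ (fun _ : Fin (d + 1) => N)) p.1) p.2 j j')
          = (fun p : Tor (fine n₀ (fun _ : Fin (d + 1) => N)) × Fin (d + 1) => E (rep (fine n₀ (fun _ : Fin (d + 1) => N)) p.1) p.2 j j')
            + (fun p : Tor (fine n₀ (fun _ : Fin (d + 1) => N)) × Fin (d + 1) =>
              (Nn (rep (fine n₀ (fun _ : Fin (d + 1) => N)) p.1) p.2
                - (σ (rep (fine n₀ (fun _ : Fin (d + 1) => N)) p.1 + e p.2) - σ (rep (fine n₀ (fun _ : Fin (d + 1) => N)) p.1))) j j') := by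
        intro j j'; funext p; simp only [Pi.add_apply, Matrix.add_apply]
      have hN'f : ∀ (y : Site (d + 1)) (κ : Fin (d + 1)), Nf (fun y => expUnit (σ y) * u y, fun y κ => E y κ + (Nn y κ - (σ (y + e κ) - σ y))) y κ
          = mlog ((gaugeAct (fun y => expUnit (σ y) * u y) V y κ : (Matrix n n ℂ)ˣ) : Matrix n n ℂ) - (E y κ + (Nn y κ - (σ (y + e κ) - σ y))) := by
        intro y κ; rw [hNf]
      have hfun : Nf (fun y => expUnit (σ y) * u y, fun y κ => E y κ + (Nn y κ - (σ (y + e κ) - σ y))) = fun y κ =>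
          mlog ((gaugeAct (fun y => expUnit (σ y) * u y) V y κ : (Matrix n n ℂ)ˣ) : Matrix n n ℂ) - (E y κ + (Nn y κ - (σ (y + e κ) - σ y))) := by
        funext y κ; exact hN'f y κ
      refine ⟨hgU, hgP, ?_, ?_, ?_, ?_, ?_, hlink, ?_, ?_, ?_, ?_⟩
      · -- `E′` skew
        intro y κ
        exact (skewAdjoint (Matrix n n ℂ)).add_mem (hEs y κ)
          ((skewAdjoint (Matrix n n ℂ)).sub_mem (hNs y κ) ((skewAdjoint (Matrix n n ℂ)).sub_mem (hσs _) (hσs _)))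
      · -- `E′` periodic
        intro y ι κ; simp only [hEP y ι κ, hNP y ι κ, add_right_comm y _ (e κ), hσP]
      · -- `E′` exact: sum of two exact fields
        intro j j'
        rw [hsum, Matrix.mulVec_add, Matrix.mulVec_add, hEx j j', hσx j j', add_zero]
      · -- `‖E′‖`
        intro y κ; exact (hE'n y κ).trans (le_of_eq (by rw [hθsucc']))
      · -- straight datum of `E′`
        intro j j' t κ
        have hsum' := congrFun (congrArg (fun w => QvOp n₀ (fun _ : Fin (d + 1) => N) *ᵥ w) (hsum j j')) (t, κ)
        simp only [Matrix.mulVec_add, Pi.add_apply, hσQ j j' t κ] at hsum'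
        calc _ = _ := congrArg (fun w : ℂ => ‖w‖) hsum'
          _ ≤ 2 * (m₀ / n₀) * (1 - θ) + m₀ / n₀ * θ := (norm_add_le _ _).trans (add_le_add (hEq j j' t κ) (hNq j j' t κ))
          _ = 2 * (m₀ / n₀) * (1 - (1 / 2 : ℝ) ^ (i + 1)) := by rw [hθsucc']; ring
      · -- `‖N′‖`
        intro y κ
        have h := hN'n y κ
        rw [← hN'f y κ, ← hθsucc'] at h
        exact h
      · -- `curl N′`
        intro z μ ν
        have h := hN'c z μ ν
        rw [← hfun, ← hθsucc'] at h
        exact h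
      · -- straight datum of `N′`
        intro j j' t κ
        have hb : ∀ p : Tor (fine n₀ (fun _ : Fin (d + 1) => N)) × Fin (d + 1),
            ‖Nf (fun y => expUnit (σ y) * u y, fun y κ => E y κ + (Nn y κ - (σ (y + e κ) - σ y))) (rep (fine n₀ (fun _ : Fin (d + 1) => N)) p.1) p.2 j j'‖
              ≤ m₀ / n₀ * (θ / 2) := by
          intro p
          have h := hN'n (rep (fine n₀ (fun _ : Fin (d + 1) => N)) p.1) p.2
          rw [← hN'f] at h
          exact (norm_apply_le_norm _ j j').trans h
        have h := norm_QvOp_mulVec_le n₀ (fun _ : Fin (d + 1) => N) _ hb (t, κ)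
        rw [← hθsucc'] at h
        exact h
      · -- `‖u′ − 1‖`
        intro y
        have hg1 : ‖((expUnit (σ y) : (Matrix n n ℂ)ˣ) : Matrix n n ℂ) - 1‖ ≤ 2 * (ct * m₀ * θ) := by
          have h := (norm_exp_sub_one_le_of_norm_le (ht y)).1
          rw [← val_expUnit] at h
          exact h.trans (NE7ExpLogSecondOrder.real_exp_sub_one_le_two_mul hct0'
            ((mul_le_of_le_one_right (mul_nonneg hct0 hm0) hθ1).trans (hct40.trans (by norm_num))))
        calc ‖((expUnit (σ y) * u y : (Matrix n n ℂ)ˣ) : Matrix n n ℂ) - 1‖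
            = ‖((expUnit (σ y) : (Matrix n n ℂ)ˣ) : Matrix n n ℂ) * (u y : Matrix n n ℂ) - 1‖ := by rw [Units.val_mul]
          _ ≤ ‖((expUnit (σ y) : (Matrix n n ℂ)ˣ) : Matrix n n ℂ) - 1‖ + ‖((u y : (Matrix n n ℂ)ˣ) : Matrix n n ℂ) - 1‖ :=
              norm_mul_sub_one_le_of_unitary (hu y) _
          _ ≤ 2 * (ct * m₀ * θ) + 4 * ct * m₀ * (1 - θ) := add_le_add hg1 (hu1 y)
          _ = 4 * ct * m₀ * (1 - (1 / 2 : ℝ) ^ (i + 1)) := by rw [hθsucc']; ring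

/-! ## §2 THE SCHEME -/

/-- **THE NEWTON SEQUENCE OF THE TOP STEP EXISTS, WITH GEOMETRIC DECAY** (see the module docstring; constants `K, K′` of T2′, functions of `d`, `card n`; `c_t, c_δ, c_r` and the
mass `m₀` are passed as named abbreviations with their defining equations). [folklore] -/
theorem newton_sequence [Nonempty n] :
    ∃ K K' : ℝ, 0 < K ∧ 0 < K' ∧ ∀ (n₀ N : ℕ) [NeZero n₀] [NeZero N]
      (V : Site (d + 1) → Fin (d + 1) → (Matrix n n ℂ)ˣ) (ε a q₀ m₀ ct cδ cr : ℝ),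
      IsUnitaryCfg V → IsPeriodicCfg V ((n₀ * N : ℕ) : ℤ) → 0 ≤ ε → SmallField V ε → 0 ≤ a →
      (∀ (y : Site (d + 1)) (κ : Fin (d + 1)), ‖((V y κ : (Matrix n n ℂ)ˣ) : Matrix n n ℂ) - 1‖ ≤ a) → 0 ≤ q₀ →
      (∀ (j j' : n) (t : Tor (fun _ : Fin (d + 1) => N)) (κ : Fin (d + 1)),
        ‖(QvOp n₀ (fun _ : Fin (d + 1) => N) *ᵥ fun p : Tor (fine n₀ (fun _ : Fin (d + 1) => N)) × Fin (d + 1) =>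
          mlog ((V (rep (fine n₀ (fun _ : Fin (d + 1) => N)) p.1) p.2 : (Matrix n n ℂ)ˣ) : Matrix n n ℂ) j j') (t, κ)‖ ≤ q₀) →
      m₀ = (n₀ : ℝ) * (2 * a) + (n₀ : ℝ) ^ 2 * (ε + 32 * (2 * a) ^ 2) + (n₀ : ℝ) * q₀ →
      ct = ((d + 1 : ℕ) : ℝ) * (Fintype.card n + K + K') → cδ = 1 + K + K' → cr = 4 * (K + K') + 1 + 8 * (ct + cδ) * cδ →
      (80 * cr + 40 * ct + 40 * cδ + 8 * (ct + cδ) * (2 * cr + cδ) + 2 * (4 * ct + 128 * cr * (cδ + 1 / 2))) * m₀ ≤ 1 →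
      ∃ (u : ℕ → Site (d + 1) → (Matrix n n ℂ)ˣ) (E : ℕ → Site (d + 1) → Fin (d + 1) → Matrix n n ℂ), ∀ i : ℕ,
        IsUnitarySite (u i) ∧ IsPeriodicSite (u i) ((n₀ * N : ℕ) : ℤ) ∧ IsSkewDir (E i) ∧ IsPeriodicDir (E i) ((n₀ * N : ℕ) : ℤ) ∧
        (∀ j j' : n, (1 - PcT n₀ (fun _ : Fin (d + 1) => N) (n₀ : ℂ)) *ᵥ ((GradOp (fine n₀ (fun _ : Fin (d + 1) => N)) (n₀ : ℂ))ᴴ *ᵥ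
          fun p : Tor (fine n₀ (fun _ : Fin (d + 1) => N)) × Fin (d + 1) => E i (rep (fine n₀ (fun _ : Fin (d + 1) => N)) p.1) p.2 j j') = 0) ∧
        (∀ (y : Site (d + 1)) (κ : Fin (d + 1)), ‖E i y κ‖ ≤ 2 * (K + K') * (m₀ / n₀)) ∧
        (∀ (j j' : n) (t : Tor (fun _ : Fin (d + 1) => N)) (κ : Fin (d + 1)),
          ‖(QvOp n₀ (fun _ : Fin (d + 1) => N) *ᵥ fun p : Tor (fine n₀ (fun _ : Fin (d + 1) => N)) × Fin (d + 1) =>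
            E i (rep (fine n₀ (fun _ : Fin (d + 1) => N)) p.1) p.2 j j') (t, κ)‖ ≤ 2 * (m₀ / n₀)) ∧
        (∀ (y : Site (d + 1)) (κ : Fin (d + 1)), ‖((gaugeAct (u i) V y κ : (Matrix n n ℂ)ˣ) : Matrix n n ℂ) - 1‖ ≤ cr * (m₀ / n₀)) ∧
        (∀ (y : Site (d + 1)) (κ : Fin (d + 1)), ‖mlog ((gaugeAct (u i) V y κ : (Matrix n n ℂ)ˣ) : Matrix n n ℂ) - E i y κ‖ ≤ m₀ / n₀ * (1 / 2) ^ i) ∧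
        (∀ y : Site (d + 1), ‖((u i y : (Matrix n n ℂ)ˣ) : Matrix n n ℂ) - 1‖ ≤ 4 * ct * m₀) ∧
        (∀ y : Site (d + 1), ‖((u (i + 1) y : (Matrix n n ℂ)ˣ) : Matrix n n ℂ) - u i y‖ ≤ 2 * ct * m₀ * (1 / 2) ^ i) ∧
        (∀ (y : Site (d + 1)) (κ : Fin (d + 1)), ‖E (i + 1) y κ - E i y κ‖ ≤ (K + K') * (m₀ / n₀) * (1 / 2) ^ i) := by
  letI : CStarAlgebra (Matrix n n ℂ) := {}
  obtain ⟨K, K', hK, hK', hΦall⟩ := exists_landauMap (d := d) (n := n)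
  refine ⟨K, K', hK, hK', ?_⟩
  intro n₀ N _ _ V ε a q₀ m₀ ct cδ cr hVu hVP hε hVε ha0 ha hq0 hq hm₀ hct hcδ hcr hΘ
  obtain ⟨Φ, hΦ⟩ := hΦall n₀ N
  -- the numbers
  have hn1 : (1 : ℝ) ≤ n₀ := by exact_mod_cast Nat.one_le_iff_ne_zero.mpr (NeZero.ne n₀)
  have hn0 : (0 : ℝ) < n₀ := by linarith
  have hD0 : (0 : ℝ) ≤ ((d + 1 : ℕ) : ℝ) := Nat.cast_nonneg _
  have hcn0 : (0 : ℝ) ≤ Fintype.card n := Nat.cast_nonneg _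
  have hct0 : 0 ≤ ct := by rw [hct]; positivity
  have hcδ1 : 1 ≤ cδ := by rw [hcδ]; linarith
  have hcδ0 : 0 ≤ cδ := by linarith
  have hcr1 : 1 ≤ cr := by
    rw [hcr]
    have : 0 ≤ 8 * (ct + cδ) * cδ := by positivity
    linarith
  obtain ⟨h2a, hB₀, hq₀x, hεx, hm0⟩ := rate_init (n₀ := (n₀ : ℝ)) hn1 ha0 hε hq0
  rw [← hm₀] at h2a hB₀ hq₀x hεx hm0
  obtain ⟨hcr80, hct40, hcδ40, hline1, hline2, hm80⟩ := rate_small hm0 hct0 hcδ1 hcr1 hΘ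
  have hm1 : m₀ ≤ 1 := by linarith
  have hx0 : 0 ≤ m₀ / n₀ := by positivity
  -- the step and the sequence (no `def`: a `Nat.rec` inside the proof)
  let Nf : (Site (d + 1) → (Matrix n n ℂ)ˣ) × (Site (d + 1) → Fin (d + 1) → Matrix n n ℂ) → (Site (d + 1) → Fin (d + 1) → Matrix n n ℂ) :=
    fun s y κ => mlog ((gaugeAct s.1 V y κ : (Matrix n n ℂ)ˣ) : Matrix n n ℂ) - s.2 y κ
  let step : (Site (d + 1) → (Matrix n n ℂ)ˣ) × (Site (d + 1) → Fin (d + 1) → Matrix n n ℂ)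
      → (Site (d + 1) → (Matrix n n ℂ)ˣ) × (Site (d + 1) → Fin (d + 1) → Matrix n n ℂ) :=
    fun s => (fun y => expUnit (Φ (Nf s) y) * s.1 y, fun y κ => s.2 y κ + (Nf s y κ - (Φ (Nf s) (y + e κ) - Φ (Nf s) y)))
  let seq : ℕ → (Site (d + 1) → (Matrix n n ℂ)ˣ) × (Site (d + 1) → Fin (d + 1) → Matrix n n ℂ) :=
    fun i => Nat.rec ((fun _ => 1, fun _ _ => 0)) (fun _ s => step s) i
  have hNf : ∀ s y κ, Nf s y κ = mlog ((gaugeAct s.1 V y κ : (Matrix n n ℂ)ˣ) : Matrix n n ℂ) - s.2 y κ := fun _ _ _ => rfl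
  have hseq_succ : ∀ i, seq (i + 1) = (fun y => expUnit (Φ (Nf (seq i)) y) * (seq i).1 y,
      fun y κ => (seq i).2 y κ + (Nf (seq i) y κ - (Φ (Nf (seq i)) (y + e κ) - Φ (Nf (seq i)) y))) := fun i => rfl
  have hseq_zero : seq 0 = (fun _ => 1, fun _ _ => 0) := rfl
  clear_value Nf seq
  have inv := fun i => newton_invariant hVu hVP hε hVε ha hq hK.le hK'.le hm0 hm1 h2a hB₀ hq₀x hεx hct hcδ hcr hcr80 hct40 hcδ40 hline1 hline2
    hΦ hNf hseq_zero hseq_succ i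
  -- THE SEQUENCE AND ITS CONSECUTIVE BOUNDS
  refine ⟨fun i => (seq i).1, fun i => (seq i).2, fun i => ?_⟩
  dsimp only
  obtain ⟨hu, huP, hEs, hEP, hEx, hEn, hEq, hWr, hNn, hNc, hNq, hu1⟩ := inv i
  have hpow1 : (1 - (1 / 2 : ℝ) ^ i) ≤ 1 := by linarith [pow_nonneg (by norm_num : (0 : ℝ) ≤ 1 / 2) i]
  have hθ0 : 0 ≤ (1 / 2 : ℝ) ^ i := by positivity
  -- the gauge function of step `i` once more (for the consecutive bounds)
  have hWu : IsUnitaryCfg (gaugeAct (seq i).1 V) := isUnitaryCfg_gaugeAct hu hVu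
  have hWP : IsPeriodicCfg (gaugeAct (seq i).1 V) ((n₀ * N : ℕ) : ℤ) := isPeriodicCfg_gaugeAct huP hVP
  have hNs : IsSkewDir (Nf (seq i)) := by
    intro y κ
    rw [hNf]
    have hr4 : cr * (m₀ / n₀) ≤ 1 / 4 :=
      ((mul_le_mul_of_nonneg_left (div_le_self hm0 hn1) (by linarith)).trans hcr80).trans (by norm_num)
    have h1 : mlog ((gaugeAct (seq i).1 V y κ : (Matrix n n ℂ)ˣ) : Matrix n n ℂ) ∈ skewAdjoint (Matrix n n ℂ) :=
      skewAdjoint.mem_iff.mpr (star_mlog_eq_neg (mem_unitaryUnits.mp (hWu y κ)) ((hWr y κ).trans hr4))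
    exact (skewAdjoint (Matrix n n ℂ)).sub_mem h1 (hEs y κ)
  have hNP : IsPeriodicDir (Nf (seq i)) ((n₀ * N : ℕ) : ℤ) := by
    intro y ι κ
    rw [hNf, hNf, hWP y ι κ, hEP y ι κ]
  obtain ⟨-, -, -, -, hσest⟩ := hΦ (Nf (seq i))
  obtain ⟨hNσ, hσn⟩ := hσest hNP _ hNc _ hNq _ hNn
  have ht : ∀ y, ‖Φ (Nf (seq i)) y‖ ≤ ct * m₀ * (1 / 2 : ℝ) ^ i := fun y => by
    refine (hσn y).trans ?_
    rw [hct]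
    exact rate_t hD0 hcn0 hK.le hK'.le hn1 hm0 hθ0 le_rfl le_rfl le_rfl
  obtain ⟨hKK, -⟩ := rate_eta (K := K) (K' := K') (n₀ := (n₀ : ℝ)) (m₀ := m₀) (θ := (1 / 2 : ℝ) ^ i) hK.le hK'.le hn1
    (ν := m₀ / n₀ * (1 / 2 : ℝ) ^ i) (γ := m₀ / (n₀ : ℝ) ^ 2 * (1 / 2 : ℝ) ^ i) (q := m₀ / n₀ * (1 / 2 : ℝ) ^ i) le_rfl le_rfl le_rfl
  refine ⟨hu, huP, hEs, hEP, hEx, fun y κ => (hEn y κ).trans ?_, fun j j' t κ => (hEq j j' t κ).trans ?_, hWr, fun y κ => ?_,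
    fun y => (hu1 y).trans ?_, fun y => ?_, fun y κ => ?_⟩
  · exact mul_le_of_le_one_right (by positivity) hpow1
  · exact mul_le_of_le_one_right (by positivity) hpow1
  · rw [← hNf]; exact hNn y κ
  · exact mul_le_of_le_one_right (by positivity) hpow1
  · -- `‖u_{i+1} − u_i‖ ≤ 2t_i`
    rw [hseq_succ]
    dsimp only
    have hg1 : ‖((expUnit (Φ (Nf (seq i)) y) : (Matrix n n ℂ)ˣ) : Matrix n n ℂ) - 1‖ ≤ 2 * (ct * m₀ * (1 / 2 : ℝ) ^ i) := by
      have h := (norm_exp_sub_one_le_of_norm_le (ht y)).1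
      rw [← val_expUnit] at h
      refine h.trans (NE7ExpLogSecondOrder.real_exp_sub_one_le_two_mul (by positivity) ?_)
      exact (mul_le_of_le_one_right (mul_nonneg hct0 hm0) (pow_le_one₀ (by norm_num) (by norm_num))).trans (by linarith)
    have hu1' : ‖(((seq i).1 y : (Matrix n n ℂ)ˣ) : Matrix n n ℂ)‖ = 1 := CStarRing.norm_of_mem_unitary (mem_unitaryUnits.mp (hu y))
    calc ‖((expUnit (Φ (Nf (seq i)) y) * (seq i).1 y : (Matrix n n ℂ)ˣ) : Matrix n n ℂ) - (seq i).1 y‖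
        = ‖(((expUnit (Φ (Nf (seq i)) y) : (Matrix n n ℂ)ˣ) : Matrix n n ℂ) - 1) * ((seq i).1 y : Matrix n n ℂ)‖ := by
          rw [Units.val_mul]; congr 1; noncomm_ring
      _ ≤ ‖((expUnit (Φ (Nf (seq i)) y) : (Matrix n n ℂ)ˣ) : Matrix n n ℂ) - 1‖ * ‖(((seq i).1 y : (Matrix n n ℂ)ˣ) : Matrix n n ℂ)‖ := norm_mul_le _ _
      _ ≤ 2 * (ct * m₀ * (1 / 2 : ℝ) ^ i) * 1 := by rw [hu1']; exact mul_le_mul_of_nonneg_right hg1 zero_le_one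
      _ = 2 * ct * m₀ * (1 / 2 : ℝ) ^ i := by ring
  · -- `‖E_{i+1} − E_i‖ ≤ η_i`
    rw [hseq_succ]
    dsimp only
    simp only [add_sub_cancel_left]
    exact (hNσ y κ).trans (hKK.trans (le_of_eq (by ring)))

end

end Summit.QuantumFields.BalabanUV.T4Continuum.NE7LandauNewtonScheme
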